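import Summits.BirchSwinnertonDyer.BirchSwinnertonDyer.Theorems.ResidualThetaTransportAtTwoResidualSignedLambdaLowerCMAtTwoStubDeepHalfAtTwoStrictPins
import Summits.BirchSwinnertonDyer.BirchSwinnertonDyer.Theorems.ResidualThetaTransportAtTwoResidualSignedLambdaLowerCMAtTwoCofreeTorsionIncl
import HarnessLib

/-!
# The one-pair pins: the tower `e_k` is ADJOINT-COMPATIBLE along the inclusion `ι : A_ρ[2^k] ↪ A_ρ[2^{k+1}]` when the roots are compatible —
# `e_{k+1}(a, ι b) = e_k([2] a, b)` (the `k`-direction square of the AwayTwo frame / of the S4₀ transfer)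

Route `ResidualThetaTransportAtTwo` (RTT), crux RSL_g `ResidualSignedLambdaLowerCMAtTwo` (stmt-BirchSwinnertonDyer-22608), line «onepair» (v3d); seat
`prover-bsd-wall-tp2-p2x-w2` g20 (`--supports`, closes nothing). THEOREMS ONLY. Sequel of `…StubDeepHalfAtTwoStrictPins` (p701765, `ePk_tower_of_zeta_sq`:
`e_k([2]a, [2]b) = e_{k+1}(a, b)²`) for the inclusion `cofreeTorsionIncl` (tp2-p2x g19, p705712): the identity the LEAD's T2(b) E3 («e-tower `e_{k+1}(β, ι υ) = e_k([2]β, υ)` from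
hePk + hζ2 + surjectivity of divPowCofreeMkTorsion», desk g18/NOTES.md HANDOFF 07:25Z) and the S4₀ mixed projection formula consume. BSD is not proved by any of this.

* `cofreeTorsionIncl_divPowCofreeMkTorsion` — `ι(2^{-k} t) = 2^{-(k+1)} (2 • t)`.
* **`ePk_succ_incl_of_zeta_sq`** — `(hζ2 : ∀ k, ζ_{k+1}² = ζ_k) → e_{k+1}(a, ι b) = e_k([2] a, b)` (both are `ζ_{k+1}` to exponents congruent mod `2^{k+1}`:
  `t₀(s ∧ 2t) = 2 t₀(s ∧ t)` and `ζ_k = ζ_{k+1}²`).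

References: [Kato2004Asterisque] §13.8 (pp. 228–229); [SilvermanAEC2009] III.8.1.
-/

set_option autoImplicit false
-- the Theorems namespace of this sub repeats the summit name by design (D-0017 nested layout)
set_option linter.dupNamespace false

noncomputable section

open scoped Classical

namespace Summit.BirchSwinnertonDyer.BirchSwinnertonDyer.Theorems.OnePair.OnePairPins

open CategoryTheory Field NumberField IsDedekindDomain
  Literature.NumberTheory.EllipticCurves Literature.NumberTheory.GaloisRepresentations
  Literature.NumberTheory.EllipticCurves.GreenbergSelmer Literature.NumberTheory.EllipticCurves.Kobayashi2003
  Summit.BirchSwinnertonDyer.BirchSwinnertonDyer.Theorems.ThetaTransport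

variable {S : Set (PadicAlgCl 2)} {W : WeierstrassCurve ℚ} [W.IsElliptic] {κ : ZpExtension ℚ 2} {γ : absoluteGaloisGroup ℚ}
  {S₀ : Finset (HeightOneSpectrum (𝓞 ℚ))} {n : ℕ} {ρ : FramedGaloisRep ℚ ↥(padicCoeffIntegers S) 2}
  {Θ : ∀ v : HeightOneSpectrum (𝓞 ℚ), ((2 : ℕ) : 𝓞 ℚ) ∈ v.asIdeal → (Cofree ρ ↥(padicCoeffField S) ≃+ (Fin n → ↥(W.geomPrimaryTorsion 2)))}
  {hΘ : ∀ v hv (δ : absoluteGaloisGroup (v.adicCompletion ℚ)) m i,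
    Θ v hv (resGalOfEmb (closureEmb (K := ℚ) (v.adicCompletion ℚ)) δ • m) i = resGalOfEmb (closureEmb (K := ℚ) (v.adicCompletion ℚ)) δ • Θ v hv m i}
  {I : Kato2004.IwasawaH1DataCoeff (FramedGaloisRep.toGaloisRep ρ) 2 κ γ}
  {Sg : AddSubgroup (subgroupH1 κ.kerSubgroup (Cofree ρ ↥(padicCoeffField S)))} [Module ↥(padicCoeffIntegers S) ↥Sg]
  (π : OnePairPins S W κ γ S₀ n ρ Θ hΘ I Sg)

/-- `ι(2^{-k} t) = 2^{-(k+1)} (2 • t)` on `T_ρ = 𝒪²` (`divPowCofreeMk (k+1) (2 • t) = 2 • divPowCofreeMk (k+1) t = divPowCofreeMk k t`). [cite: Kato2004Asterisque, §13.8 (p. 228)] -/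
theorem cofreeTorsionIncl_divPowCofreeMkTorsion (k : ℕ) (t : Fin 2 → ↥(padicCoeffIntegers S)) :
    (cofreeTorsionIncl S ρ k).hom (divPowCofreeMkTorsion S ρ k t) = divPowCofreeMkTorsion S ρ (k + 1) ((2 : ℕ) • t) := by
  refine Subtype.ext ?_
  rw [coe_cofreeTorsionIncl_apply, coe_divPowCofreeMkTorsion_apply, coe_divPowCofreeMkTorsion_apply, map_nsmul, smul_divPowCofreeMk_succ]

/-- The wedge is homogeneous: `s ∧ (2 • t) = 2 • (s ∧ t)`. [folklore] -/
private theorem wedge_two_nsmul (s t : Fin 2 → ↥(padicCoeffIntegers S)) :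
    s 0 * ((2 : ℕ) • t) 1 - s 1 * ((2 : ℕ) • t) 0 = (2 : ℕ) • (s 0 * t 1 - s 1 * t 0) := by
  simp only [Pi.smul_apply, smul_sub, nsmul_eq_mul]
  ring

/-- **`e_{k+1}(a, ι b) = e_k([2] a, b)` for compatible roots** (`ζ_{k+1}² = ζ_k`): write `a = 2^{-(k+1)} s`, `b = 2^{-k} t`; then `ι b = 2^{-(k+1)}(2t)`, `[2] a = 2^{-k} s`, and both sides
are `ζ_{k+1}` raised to exponents `≡ 2 t₀(s ∧ t) (mod 2^{k+1})` (`hePk`, `val_toZModPow_eq_mod`). The `k`-direction square of the one-pair tower: consumed by the LEAD's `AwayPins`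
existence (E3) and by the S4₀ mixed projection formula. [cite: Kato2004Asterisque, §13.8 (pp. 228–229)] -/
theorem ePk_succ_incl_of_zeta_sq (hζ2 : ∀ k, π.ζ (k + 1) ^ 2 = π.ζ k) (k : ℕ)
    (a : ↥(AddSubgroup.torsionBy (Cofree ρ ↥(padicCoeffField S)) ((2 ^ (k + 1) : ℕ) : ℤ)))
    (b : ↥(AddSubgroup.torsionBy (Cofree ρ ↥(padicCoeffField S)) ((2 ^ k : ℕ) : ℤ))) :
    π.ePk (k + 1) a ((cofreeTorsionIncl S ρ k).hom b) = π.ePk k ((cofreeTorsionPow S ρ k).hom a) b := by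
  obtain ⟨s, rfl⟩ := divPowCofreeMkTorsion_surjective S ρ (k + 1) a
  obtain ⟨t, rfl⟩ := divPowCofreeMkTorsion_surjective S ρ k b
  rw [cofreeTorsionIncl_divPowCofreeMkTorsion, cofreeTorsionPow_divPowCofreeMkTorsion_succ, π.hePk, π.hePk, wedge_two_nsmul, map_nsmul, map_nsmul,
    ← hζ2 k, ← pow_mul]
  -- exponents agree mod `2^(k+1)`
  haveI : NeZero (2 ^ (k + 1)) := ⟨pow_ne_zero _ two_ne_zero⟩
  have key : ∀ m : ℕ, π.ζ (k + 1) ^ m = π.ζ (k + 1) ^ (m % 2 ^ (k + 1)) := fun m ↦ by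
    conv_lhs => rw [← Nat.mod_add_div m (2 ^ (k + 1)), pow_add, pow_mul, (π.hζ (k + 1)).pow_eq_one, one_pow, mul_one]
  set Y := PadicInt.toZModPow (k + 1) (π.t₀ (s 0 * t 1 - s 1 * t 0)) with hY
  have hA : (2 • Y).val % 2 ^ (k + 1) = (2 * (PadicInt.toZModPow k (π.t₀ (s 0 * t 1 - s 1 * t 0))).val) % 2 ^ (k + 1) := by
    have hmod : ∀ a : ℕ, 2 * a % 2 ^ (k + 1) = 2 * (a % 2 ^ k) % 2 ^ (k + 1) := fun a ↦ by
      rw [pow_succ', ← Nat.mul_mod_mul_left, Nat.mod_mod]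
    rw [val_toZModPow_eq_mod k, ← hY, two_nsmul, ZMod.val_add, Nat.mod_mod, ← two_mul]
    exact hmod Y.val
  rw [key (2 • Y).val, hA, ← key]

end Summit.BirchSwinnertonDyer.BirchSwinnertonDyer.Theorems.OnePair.OnePairPins

end
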